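import Mathlib.Analysis.PSeries
import Mathlib.NumberTheory.Harmonic.Bounds
import HarnessLib

/-!
# Lattice shell sums on `ℕ₀³` for the LHY Riemann sum: `∑ |k|∞⁻³ ≲ log`, `∑ |k|∞⁻⁵ ≲ N⁻²`

Topic `Literature/MathematicalPhysics/QuantumManyBody`, namespace `BoseGas` (provefact
`Literature.MathematicalPhysics.QuantumManyBody.BoseGas.Junge2026_neumannBox_pinnedLowerBound`;
second file of the Riemann-sum step of [FournaisEtAl2024, Lemma 8.1], after
`LHYIntegrandBounds.lean`). Comparing the Bogoliubov mode sum over the Neumann momenta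
`(π/ℓ)ℕ₀³` with the LHY integral cell by cell produces, for the cell at `k ∈ ℕ₀³ ∖ 0`, an error
`≲ h⁴ (h|k|)⁻³` near the origin (`|f'| ≤ 6r⁻³`) and `≲ h⁴(h|k|)⁻⁵` far away (`|f'| ≤ 3r⁻⁵`); summing
these needs the two counting estimates of this file, organised by shells of the max-norm
`|k|∞ = maxᵢ kᵢ = Finset.univ.sup k` (`|k|₂/√3 ≤ |k|∞ ≤ |k|₂`):

* `card_filter_sup_eq_le` — the shell `{k ∈ ℕ₀³ : |k|∞ = j}` has at most
  `(j+1)³ - j³ ≤ 3(j+1)²` points;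
* `sum_inv_sup_pow_three_le` — `∑_{k ∈ u, 1 ≤ |k|∞ ≤ N} |k|∞⁻³ ≤ 12(1 + log N)` for every finite
  `u ⊆ ℕ₀³` (shells + the harmonic bound `H_N ≤ 1 + log N`);
* `sum_inv_sup_pow_five_le` — `∑_{k ∈ u, |k|∞ ≥ N} |k|∞⁻⁵ ≤ 24/N²` for every finite `u` and `N ≥ 1`
  (shells + `∑_{j ≥ N} j⁻² ≤ 2/N`).

Finite `u` throughout, so that the bounds feed `Real.tsum_le_of_sum_le` / `summable_of_sum_le`
without any summability bookkeeping. No definitions.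

## References

* [FournaisEtAl2024] S. Fournais, L. Junge, T. Girardot, L. Morin, M. Olivieri, A. Triay, *The free
  energy of dilute Bose gases at low temperatures interacting via strong potentials*,
  arXiv:2408.14222, Ann. Henri Poincaré (2026): Lemma 8.1 (proof, the Riemann-sum step).
-/

noncomputable section

open Finset

namespace Literature.MathematicalPhysics.QuantumManyBody.BoseGas

/-! ### The max-norm balls `{k : ∀ i, kᵢ < j}` and shells `{|k|∞ = j}` -/

/-- The ball `{k ∈ ℕ₀³ : kᵢ < j ∀ i}` has `j³` points. [folklore] -/
theorem card_piFinset_range (j : ℕ) :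
    (Fintype.piFinset fun _ : Fin 3 => range j).card = j ^ 3 := by
  rw [Fintype.card_piFinset]
  simp [Finset.prod_const]

/-- Membership in the ball. [folklore] -/
theorem mem_piFinset_range {j : ℕ} {k : Fin 3 → ℕ} :
    k ∈ Fintype.piFinset (fun _ : Fin 3 => range j) ↔ ∀ i, k i < j := by
  simp [Fintype.mem_piFinset]

/-- In the ball the max-norm is `< j`. [folklore] -/
theorem sup_lt_of_mem_piFinset_range {j : ℕ} {k : Fin 3 → ℕ}
    (h : k ∈ Fintype.piFinset (fun _ : Fin 3 => range j)) : univ.sup k < j := by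
  have h' := mem_piFinset_range.1 h
  have hj : 0 < j := lt_of_le_of_lt (Nat.zero_le _) (h' 0)
  exact (Finset.sup_lt_iff hj).2 fun i _ => h' i

/-- Max-norm `< j` puts `k` in the ball. [folklore] -/
theorem mem_piFinset_range_of_sup_lt {j : ℕ} {k : Fin 3 → ℕ} (h : univ.sup k < j) :
    k ∈ Fintype.piFinset (fun _ : Fin 3 => range j) :=
  mem_piFinset_range.2 fun i => lt_of_le_of_lt (Finset.le_sup (f := k) (mem_univ i)) h

/-- **The shell `{|k|∞ = j}` has at most `(j+1)³ - j³ ≤ 3(j+1)²` points** (in any finite `s`).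
[folklore] -/
theorem card_filter_sup_eq_le (j : ℕ) (s : Finset (Fin 3 → ℕ)) :
    ((s.filter fun k => univ.sup k = j).card : ℝ) ≤ 3 * ((j : ℝ) + 1) ^ 2 := by
  set A := Fintype.piFinset (fun _ : Fin 3 => range (j + 1)) with hA
  set B := Fintype.piFinset (fun _ : Fin 3 => range j) with hB
  have hBA : B ⊆ A := fun k hk => mem_piFinset_range.2 fun i => Nat.lt_succ_of_lt
    (mem_piFinset_range.1 hk i)
  have hsub : (s.filter fun k => univ.sup k = j) ⊆ A \ B := by
    intro k hk
    rw [mem_filter] at hk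
    rw [mem_sdiff]
    refine ⟨mem_piFinset_range_of_sup_lt (by omega), fun h => ?_⟩
    have := sup_lt_of_mem_piFinset_range h
    omega
  have h1 : (s.filter fun k => univ.sup k = j).card ≤ A.card - B.card := by
    rw [← card_sdiff_of_subset hBA]
    exact card_le_card hsub
  have h2 : ((s.filter fun k => univ.sup k = j).card : ℝ) ≤ (A.card : ℝ) - B.card := by
    have := (Nat.cast_le (α := ℝ)).2 h1
    rwa [Nat.cast_sub (card_le_card hBA)] at this
  rw [hA, hB, card_piFinset_range, card_piFinset_range] at h2
  push_cast at h2
  have hj : (0 : ℝ) ≤ j := Nat.cast_nonneg j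
  nlinarith [h2, hj]

/-! ### `∑ |k|∞⁻³` over `1 ≤ |k|∞ ≤ N` -/

/-- **`∑_{k ∈ u, 1 ≤ |k|∞ ≤ N} |k|∞⁻³ ≤ 12(1 + log N)`** (`u` finite): by shells,
`≤ ∑_{j=1}^N 3(j+1)²/j³ ≤ 12 H_N ≤ 12(1 + log N)`. [cite: FournaisEtAl2024, Lemma 8.1 (proof)] -/
theorem sum_inv_sup_pow_three_le (N : ℕ) (u : Finset (Fin 3 → ℕ)) :
    ∑ k ∈ u.filter (fun k => 0 < univ.sup k ∧ univ.sup k ≤ N), (((univ.sup k : ℕ) : ℝ) ^ 3)⁻¹ ≤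
      12 * (1 + Real.log N) := by
  set T := u.filter (fun k => 0 < univ.sup k ∧ univ.sup k ≤ N) with hT
  have hmaps : ∀ k ∈ T, univ.sup k ∈ Icc 1 N := fun k hk => by
    have h := (mem_filter.1 hk).2
    exact mem_Icc.2 ⟨h.1, h.2⟩
  rw [← sum_fiberwise_of_maps_to hmaps]
  have hinner : ∀ j ∈ Icc 1 N,
      ∑ k ∈ T.filter (fun k => univ.sup k = j), (((univ.sup k : ℕ) : ℝ) ^ 3)⁻¹ ≤ 12 * ((j : ℝ))⁻¹ := by
    intro j hj
    have hj1 : (1 : ℝ) ≤ j := by exact_mod_cast (mem_Icc.1 hj).1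
    have hj0 : (0 : ℝ) < j := by linarith
    calc ∑ k ∈ T.filter (fun k => univ.sup k = j), (((univ.sup k : ℕ) : ℝ) ^ 3)⁻¹
        = ∑ k ∈ T.filter (fun k => univ.sup k = j), (((j : ℕ) : ℝ) ^ 3)⁻¹ :=
          sum_congr rfl fun k hk => by rw [(mem_filter.1 hk).2]
      _ = ((T.filter fun k => univ.sup k = j).card : ℝ) * ((j : ℝ) ^ 3)⁻¹ := by
          rw [sum_const, nsmul_eq_mul]
      _ ≤ 3 * ((j : ℝ) + 1) ^ 2 * ((j : ℝ) ^ 3)⁻¹ := by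
          gcongr
          exact card_filter_sup_eq_le j T
      _ ≤ 12 * (j : ℝ) ^ 2 * ((j : ℝ) ^ 3)⁻¹ := by
          apply mul_le_mul_of_nonneg_right _ (by positivity)
          nlinarith
      _ = 12 * ((j : ℝ))⁻¹ := by field_simp
  calc ∑ j ∈ Icc 1 N, ∑ k ∈ T.filter (fun k => univ.sup k = j), (((univ.sup k : ℕ) : ℝ) ^ 3)⁻¹
      ≤ ∑ j ∈ Icc 1 N, 12 * ((j : ℝ))⁻¹ := sum_le_sum hinner
    _ = 12 * ((harmonic N : ℚ) : ℝ) := by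
        rw [← mul_sum, harmonic_eq_sum_Icc]
        push_cast
        rfl
    _ ≤ 12 * (1 + Real.log N) := by
        gcongr
        exact harmonic_le_one_add_log N

/-! ### `∑ |k|∞⁻⁵` over `|k|∞ ≥ N` -/

/-- `∑_{j=N}^{M} j⁻² ≤ 2/N` (`N ≥ 1`). [folklore] -/
theorem sum_Icc_inv_sq_le {N : ℕ} (hN : 1 ≤ N) (M : ℕ) :
    ∑ j ∈ Icc N M, ((j : ℝ) ^ 2)⁻¹ ≤ 2 / N := by
  have hsub : Icc N M ⊆ Ioo (N - 1) (M + 1) := fun j hj => by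
    rw [mem_Icc] at hj; rw [mem_Ioo]; omega
  calc ∑ j ∈ Icc N M, ((j : ℝ) ^ 2)⁻¹ ≤ ∑ j ∈ Ioo (N - 1) (M + 1), ((j : ℝ) ^ 2)⁻¹ :=
        sum_le_sum_of_subset_of_nonneg hsub fun j _ _ => by positivity
    _ ≤ 2 / ((N - 1 : ℕ) + 1) := sum_Ioo_inv_sq_le _ _
    _ = 2 / N := by
        congr 1
        rw [show ((N - 1 : ℕ) : ℝ) + 1 = ((N - 1 + 1 : ℕ) : ℝ) by push_cast; ring,
          Nat.sub_add_cancel hN]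

/-- **`∑_{k ∈ u, |k|∞ ≥ N} |k|∞⁻⁵ ≤ 24/N²`** (`N ≥ 1`, `u` finite): by shells,
`≤ ∑_{j ≥ N} 3(j+1)²/j⁵ ≤ (12/N)∑_{j ≥ N} j⁻² ≤ 24/N²`. [cite: FournaisEtAl2024, Lemma 8.1 (proof)] -/
theorem sum_inv_sup_pow_five_le {N : ℕ} (hN : 1 ≤ N) (u : Finset (Fin 3 → ℕ)) :
    ∑ k ∈ u.filter (fun k => N ≤ univ.sup k), (((univ.sup k : ℕ) : ℝ) ^ 5)⁻¹ ≤
      24 / (N : ℝ) ^ 2 := by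
  set M := u.sup (fun k => univ.sup k) with hM
  set T := u.filter (fun k => N ≤ univ.sup k) with hT
  have hN0 : (0 : ℝ) < N := by exact_mod_cast hN
  have hmaps : ∀ k ∈ T, univ.sup k ∈ Icc N M := fun k hk => by
    have h := mem_filter.1 hk
    exact mem_Icc.2 ⟨h.2, Finset.le_sup (f := fun k => univ.sup k) h.1⟩
  rw [← sum_fiberwise_of_maps_to hmaps]
  have hinner : ∀ j ∈ Icc N M,
      ∑ k ∈ T.filter (fun k => univ.sup k = j), (((univ.sup k : ℕ) : ℝ) ^ 5)⁻¹ ≤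
        12 / N * ((j : ℝ) ^ 2)⁻¹ := by
    intro j hj
    have hjN : (N : ℝ) ≤ j := by exact_mod_cast (mem_Icc.1 hj).1
    have hj1 : (1 : ℝ) ≤ j := le_trans (by exact_mod_cast hN) hjN
    have hj0 : (0 : ℝ) < j := by linarith
    calc ∑ k ∈ T.filter (fun k => univ.sup k = j), (((univ.sup k : ℕ) : ℝ) ^ 5)⁻¹
        = ∑ k ∈ T.filter (fun k => univ.sup k = j), (((j : ℕ) : ℝ) ^ 5)⁻¹ :=
          sum_congr rfl fun k hk => by rw [(mem_filter.1 hk).2]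
      _ = ((T.filter fun k => univ.sup k = j).card : ℝ) * ((j : ℝ) ^ 5)⁻¹ := by
          rw [sum_const, nsmul_eq_mul]
      _ ≤ 3 * ((j : ℝ) + 1) ^ 2 * ((j : ℝ) ^ 5)⁻¹ := by
          gcongr
          exact card_filter_sup_eq_le j T
      _ ≤ 12 * (j : ℝ) ^ 2 * ((j : ℝ) ^ 5)⁻¹ := by
          apply mul_le_mul_of_nonneg_right _ (by positivity)
          nlinarith
      _ = 12 * ((j : ℝ) ^ 3)⁻¹ := by field_simp
      _ ≤ 12 / N * ((j : ℝ) ^ 2)⁻¹ := by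
          rw [div_mul_eq_mul_div, le_div_iff₀ hN0]
          calc 12 * ((j : ℝ) ^ 3)⁻¹ * N ≤ 12 * ((j : ℝ) ^ 3)⁻¹ * j := by gcongr
            _ = 12 * ((j : ℝ) ^ 2)⁻¹ := by field_simp
  calc ∑ j ∈ Icc N M, ∑ k ∈ T.filter (fun k => univ.sup k = j), (((univ.sup k : ℕ) : ℝ) ^ 5)⁻¹
      ≤ ∑ j ∈ Icc N M, 12 / N * ((j : ℝ) ^ 2)⁻¹ := sum_le_sum hinner
    _ = 12 / N * ∑ j ∈ Icc N M, ((j : ℝ) ^ 2)⁻¹ := by rw [mul_sum]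
    _ ≤ 12 / N * (2 / N) := by
        gcongr
        exact sum_Icc_inv_sq_le hN M
    _ = 24 / (N : ℝ) ^ 2 := by
        field_simp
        ring

end Literature.MathematicalPhysics.QuantumManyBody.BoseGas

end
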